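import Literature.Topology.FourManifolds.HandleAttachingMaps
import Literature.Topology.FourManifolds.SmoothEmbeddingComp
import Literature.Topology.FourManifolds.ClosedBallSmoothMaps
import Literature.Topology.FourManifolds.PalaisBallComplement
import HarnessLib

/-!
# Dual handles, I: the block swap `x_λ ↔ x_μ` of Kosinski's model handle and the belt tube
(brick T3a-1a of the sub-goal T3 "the complement piece is the cap with the DUAL handles" of stub
`stub_steinRealisation` (NF6), line `modp-braid-orbits` r11, crux
`ConvexBisection.AcyclicBisectionExists`, item stmt-SmoothPoincare4-10508; wave 1, lead c5)

Kosinski, *Differential Manifolds* (1993), VI §6 attaches a `λ`-handle to `M` along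
`h̄ : T → M`, `T = {x ∈ Dᵐ | x_λ ≠ 0}`, by gluing `Dᵐ ∖ S` (`S = {|x_λ| = 1}` the attaching
sphere) to `M ∖ h̄(S)` along `x ∼ h̄ α(x)`; the belt sphere is `{x_λ = 0, |x_μ| = 1}` and the
belt disc `{x_λ = 0}`.  Milnor (*h-cobordism*, 1965, §3, "dual handle presentation") and
Kosinski (VII §1, VI §8) read an elementary cobordism upside down: the SAME handle, with the
roles of `x_λ` and `x_μ` exchanged, is a handle of the dual index attached to the other end
along the BELT sphere.  For 4-dimensional 2-handles (`λ = μ = 2`) the exchange is the block swap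
`σ (x₀, x₁, x₂, x₃) = (x₂, x₃, x₀, x₁)` of `ℝ⁴ = ℝ²_λ × ℝ²_μ`, a linear isometry with
`|σ(x)_λ|² = |x_μ|²`, `|σ(x)_μ|² = |x_λ|²`, mapping Kosinski's tube `T` onto the BELT TUBE
`T^∨ = {x ∈ D⁴ | x_μ ≠ 0} ⊆ D⁴ ∖ S` and `S` onto the belt sphere.  This file (model only):

* `swapIso`, `lamSq_swapIso`, `muSq_swapIso`, `swapIso_swapIso` — the block swap `σ`;
* `muTube = T^∨`, `swapDiffeo : T ≅ T^∨` (restriction of `closedBallCongr σ`, `opensCongr`),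
  **`swapTube : T → D⁴ ∖ S`** (an open smooth embedding onto `{x_μ ≠ 0}`: `range_swapTube`,
  `isSmoothEmbedding_swapTube`), `swapPH` (the same as a partial diffeomorphism with
  `contMDiffOn_swapPH_symm`, the shape consumed by `IsSmoothEmbedding.comp_openPartialHomeomorph`);
* `beltCirclePt θ = σ (coreTubePt θ) = (0, 0, θ)` — the belt circle, `exists_beltCirclePt_eq`
  (every belt-sphere point `|x_μ| = 1` is one);
* `helper_dualAttachingMap_swapTube` (registered) — the package in tree vocabulary.

The sequel `…DualHandleBeltMap.lean` composes `σ` with the handle embeddings `D.jB i` of a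
multi-attachment: the belt tube of each handle is an attaching map of the attached manifold, the
first node of the dual-handle presentation of the complement piece `W₂` of a sorted fibred model
(Baykur 2006, proof of Thm. 5.1).  Everything here is proved; no named facts.

## References
* A. A. Kosinski, *Differential Manifolds*, Academic Press (1993), VI §6 (handles, belt disc),
  VI §8, VII §1 (dual presentation). [Kosinski1993]
* J. Milnor, *Lectures on the h-cobordism theorem* (1965), §3 (dual handles). [MilnorHCobordism1965]
* R. E. Gompf, A. I. Stipsicz, *4-Manifolds and Kirby Calculus* (1999), §8.2, pp. 289–291.
  [GompfStipsicz1999]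
-/

noncomputable section

-- the prescribed namespace `Summit.<P>.<Sub>.…` duplicates `SmoothPoincare4` (P = Sub)
set_option linter.dupNamespace false

open scoped Manifold ContDiff Topology

namespace Summit.SmoothPoincare4.SmoothPoincare4.Theorems.AcyclicBisectionExists.ModpBraidOrbits

open Set Function Filter Metric Topology
open Literature.Topology.FourManifolds Literature.Topology.FourManifolds.HandleAttachingMap

universe u v

/-! ### §1 The block swap `σ (x_λ, x_μ) = (x_μ, x_λ)` of `ℝ⁴ = ℝ²_λ × ℝ²_μ` -/

/-- The permutation `(0 2)(1 3)` of the four coordinates. [folklore] -/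
def swapPerm : Equiv.Perm (Fin 4) := (Equiv.swap (0 : Fin 4) 2).trans (Equiv.swap 1 3)

/-- `(0 2)(1 3)` is an involution. [folklore] -/
theorem swapPerm_symm : swapPerm.symm = swapPerm := Equiv.ext fun i => by fin_cases i <;> rfl

/-- `swapPerm 0 = 2`. [folklore] -/
@[simp] theorem swapPerm_zero : swapPerm 0 = 2 := by decide
/-- `swapPerm 1 = 3`. [folklore] -/
@[simp] theorem swapPerm_one : swapPerm 1 = 3 := by decide
/-- `swapPerm 2 = 0`. [folklore] -/
@[simp] theorem swapPerm_two : swapPerm 2 = 0 := by decide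
/-- `swapPerm 3 = 1`. [folklore] -/
@[simp] theorem swapPerm_three : swapPerm 3 = 1 := by decide

/-- **The block swap `σ (x_λ, x_μ) = (x_μ, x_λ)`** of `ℝ⁴ = ℝ² × ℝ²`, as a linear isometry: the
symmetry of Kosinski's model handle `D⁴ ⊃ T` exchanging the roles of core and cocore (Milnor's
dual handle). [cite: MilnorHCobordism1965, §3] -/
def swapIso : EuclideanSpace ℝ (Fin 4) ≃ₗᵢ[ℝ] EuclideanSpace ℝ (Fin 4) :=
  LinearIsometryEquiv.piLpCongrLeft 2 ℝ ℝ swapPerm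

/-- Coordinates of `σ u`. [folklore] -/
theorem swapIso_apply (u : EuclideanSpace ℝ (Fin 4)) (i : Fin 4) : swapIso u i = u (swapPerm i) := by
  show (LinearIsometryEquiv.piLpCongrLeft 2 ℝ ℝ swapPerm u).ofLp i = u.ofLp (swapPerm i)
  rw [LinearIsometryEquiv.piLpCongrLeft_apply, Equiv.piCongrLeft'_apply, swapPerm_symm]

/-- `(σ u)₀ = u₂`. [folklore] -/
@[simp] theorem swapIso_apply_zero (u : EuclideanSpace ℝ (Fin 4)) : swapIso u 0 = u 2 :=
  swapIso_apply u 0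
/-- `(σ u)₁ = u₃`. [folklore] -/
@[simp] theorem swapIso_apply_one (u : EuclideanSpace ℝ (Fin 4)) : swapIso u 1 = u 3 :=
  swapIso_apply u 1
/-- `(σ u)₂ = u₀`. [folklore] -/
@[simp] theorem swapIso_apply_two (u : EuclideanSpace ℝ (Fin 4)) : swapIso u 2 = u 0 :=
  swapIso_apply u 2
/-- `(σ u)₃ = u₁`. [folklore] -/
@[simp] theorem swapIso_apply_three (u : EuclideanSpace ℝ (Fin 4)) : swapIso u 3 = u 1 :=
  swapIso_apply u 3

/-- **`|σ(x)_λ|² = |x_μ|²`.** [cite: Kosinski1993, VI §6] -/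
theorem lamSq_swapIso (u : EuclideanSpace ℝ (Fin 4)) : lamSq 2 (swapIso u) = muSq 2 u := by
  rw [lamSq_two_fin_four, muSq_two_fin_four, swapIso_apply_zero, swapIso_apply_one]

/-- **`|σ(x)_μ|² = |x_λ|²`.** [cite: Kosinski1993, VI §6] -/
theorem muSq_swapIso (u : EuclideanSpace ℝ (Fin 4)) : muSq 2 (swapIso u) = lamSq 2 u := by
  rw [lamSq_two_fin_four, muSq_two_fin_four, swapIso_apply_two, swapIso_apply_three]

/-- `σ` is an involution. [folklore] -/
@[simp] theorem swapIso_swapIso (u : EuclideanSpace ℝ (Fin 4)) : swapIso (swapIso u) = u := by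
  ext i; fin_cases i <;> simp

/-- `σ⁻¹ = σ`. [folklore] -/
theorem swapIso_symm : swapIso.symm = swapIso := by
  ext u i
  rw [← swapIso_swapIso (swapIso.symm u), LinearIsometryEquiv.apply_symm_apply]

/-- `σ` preserves the norm. [folklore] -/
theorem norm_swapIso (u : EuclideanSpace ℝ (Fin 4)) : ‖swapIso u‖ = ‖u‖ := swapIso.norm_map u

/-! ### §2 The belt tube `T^∨ = {x_μ ≠ 0}` and the swap `T → D⁴ ∖ S` -/

/-- Continuity of `|x_μ|²`. [folklore] -/
theorem continuous_muSq {m : ℕ} (k : ℕ) : Continuous (muSq (m := m) k) := by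
  unfold muSq; fun_prop

/-- **The belt tube `T^∨ = {x ∈ D⁴ | x_μ ≠ 0}`**, a tubular neighbourhood of the belt circle
`{x_λ = 0, |x_μ| = 1}` in `D⁴` (the image of Kosinski's tube `T` under `σ`), as an open subset
of `D⁴`. [cite: Kosinski1993, VI §6] -/
def muTube : TopologicalSpace.Opens (closedBall (0 : EuclideanSpace ℝ (Fin 4)) 1) :=
  ⟨{u | muSq 2 (u : EuclideanSpace ℝ (Fin 4)) ≠ 0},
    (isOpen_ne.preimage (continuous_muSq 2)).preimage continuous_subtype_val⟩

/-- Membership in `T^∨`: `x_μ ≠ 0`. [folklore] -/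
@[simp] theorem mem_muTube {u : closedBall (0 : EuclideanSpace ℝ (Fin 4)) 1} :
    u ∈ muTube ↔ muSq 2 (u : EuclideanSpace ℝ (Fin 4)) ≠ 0 := Iff.rfl

/-- On the closed ball, `x_μ ≠ 0` forces `|x_λ|² ≠ 1`: **the belt tube lies in the handle
`D⁴ ∖ S`**. [cite: Kosinski1993, VI §6] -/
theorem lamSq_ne_one_of_muSq_ne_zero {u : closedBall (0 : EuclideanSpace ℝ (Fin 4)) 1}
    (hu : muSq 2 (u : EuclideanSpace ℝ (Fin 4)) ≠ 0) : lamSq 2 (u : EuclideanSpace ℝ (Fin 4)) ≠ 1 :=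
  fun h1 => hu (muSq_eq_zero_of_lamSq_eq_one (mem_closedBall_zero_iff.1 u.2) h1).1

/-- `T^∨ ⊆ D⁴ ∖ S`. [cite: Kosinski1993, VI §6] -/
theorem muTube_le_beltPiece : muTube ≤ beltPiece 3 2 := fun _ hu => lamSq_ne_one_of_muSq_ne_zero hu

/-- `x ∈ T ↔ σ x ∈ T^∨`. [folklore] -/
theorem mem_handleTube_iff_swap (u : closedBall (0 : EuclideanSpace ℝ (Fin 4)) 1) :
    u ∈ handleTube 3 2 ↔ closedBallCongr swapIso u ∈ muTube := by
  rw [mem_handleTube, mem_muTube, coe_closedBallCongr, muSq_swapIso]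

/-- **`σ : T ≅ T^∨`**, the block swap as a diffeomorphism of Kosinski's tube onto the belt tube
(restriction of `closedBallCongr σ`, `opensCongr`). [cite: MilnorHCobordism1965, §3] -/
def swapDiffeo : ↥(handleTube 3 2) ≃ₘ⟮𝓡∂ 4, 𝓡∂ 4⟯ ↥muTube :=
  opensCongr (closedBallCongr swapIso) (handleTube 3 2) muTube mem_handleTube_iff_swap

/-- `swapDiffeo` acts as `σ`. [folklore] -/
@[simp] theorem coe_coe_swapDiffeo (y : ↥(handleTube 3 2)) :
    (((swapDiffeo y : ↥muTube) : closedBall (0 : EuclideanSpace ℝ (Fin 4)) 1) :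
      EuclideanSpace ℝ (Fin 4)) = swapIso ((y : closedBall (0 : EuclideanSpace ℝ (Fin 4)) 1) :
        EuclideanSpace ℝ (Fin 4)) := rfl

/-- **The swap `T → D⁴ ∖ S`, `y ↦ σ y`** (onto the belt tube). [cite: MilnorHCobordism1965, §3] -/
def swapTube (y : ↥(handleTube 3 2)) : ↥(beltPiece 3 2) :=
  TopologicalSpace.Opens.inclusion muTube_le_beltPiece (swapDiffeo y)

/-- `swapTube` acts as `σ`. [folklore] -/
@[simp] theorem coe_coe_swapTube (y : ↥(handleTube 3 2)) :
    (((swapTube y : ↥(beltPiece 3 2)) : closedBall (0 : EuclideanSpace ℝ (Fin 4)) 1) :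
      EuclideanSpace ℝ (Fin 4)) = swapIso ((y : closedBall (0 : EuclideanSpace ℝ (Fin 4)) 1) :
        EuclideanSpace ℝ (Fin 4)) := rfl

/-- The underlying ball point of `swapTube y` is that of `swapDiffeo y`. [folklore] -/
@[simp] theorem coe_swapTube (y : ↥(handleTube 3 2)) :
    ((swapTube y : ↥(beltPiece 3 2)) : closedBall (0 : EuclideanSpace ℝ (Fin 4)) 1) =
      (swapDiffeo y : ↥muTube) := rfl

/-- `swapTube` is smooth (a diffeomorphism followed by an inclusion of open submanifolds).
[folklore] -/
theorem contMDiff_swapTube : ContMDiff (𝓡∂ 4) (𝓡∂ 4) ∞ swapTube :=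
  (contMDiff_inclusion muTube_le_beltPiece).comp swapDiffeo.contMDiff

/-- `swapTube` is an open embedding. [folklore] -/
theorem isOpenEmbedding_swapTube : IsOpenEmbedding swapTube :=
  (TopologicalSpace.Opens.isOpenEmbedding_of_le muTube_le_beltPiece).comp
    swapDiffeo.toHomeomorph.isOpenEmbedding

/-- `swapTube` is continuous. [folklore] -/
theorem continuous_swapTube : Continuous swapTube := isOpenEmbedding_swapTube.continuous

/-- `swapTube` is injective. [folklore] -/
theorem injective_swapTube : Injective swapTube := isOpenEmbedding_swapTube.injective

/-- `|σ(y)_μ|² = |y_λ|² ≠ 0` on `T`. [folklore] -/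
theorem muSq_swapTube_ne_zero (y : ↥(handleTube 3 2)) :
    muSq 2 (((swapTube y : ↥(beltPiece 3 2)) : closedBall (0 : EuclideanSpace ℝ (Fin 4)) 1) :
      EuclideanSpace ℝ (Fin 4)) ≠ 0 := by
  rw [coe_coe_swapTube, muSq_swapIso]; exact y.2

/-- `|σ(y)_λ|² = |y_μ|²` on `T`. [folklore] -/
theorem lamSq_swapTube (y : ↥(handleTube 3 2)) :
    lamSq 2 (((swapTube y : ↥(beltPiece 3 2)) : closedBall (0 : EuclideanSpace ℝ (Fin 4)) 1) :
      EuclideanSpace ℝ (Fin 4)) =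
      muSq 2 ((y : closedBall (0 : EuclideanSpace ℝ (Fin 4)) 1) : EuclideanSpace ℝ (Fin 4)) := by
  rw [coe_coe_swapTube, lamSq_swapIso]

/-- **The range of the swap is the belt tube `{x_μ ≠ 0} ⊆ D⁴ ∖ S`.** [cite: Kosinski1993, VI §6] -/
theorem range_swapTube :
    range swapTube = {b : ↥(beltPiece 3 2) |
      muSq 2 ((b : closedBall (0 : EuclideanSpace ℝ (Fin 4)) 1) : EuclideanSpace ℝ (Fin 4)) ≠ 0} := by
  ext b
  constructor
  · rintro ⟨y, rfl⟩
    exact muSq_swapTube_ne_zero y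
  · intro hb
    refine ⟨swapDiffeo.symm ⟨b.1, hb⟩, Subtype.ext ?_⟩
    rw [coe_swapTube, Diffeomorph.apply_symm_apply]

/-- The range of the swap is open. [folklore] -/
theorem isOpen_range_swapTube : IsOpen (range swapTube) := isOpenEmbedding_swapTube.isOpen_range

/-- A base point of `T` (the point `(1, 0, 0, 0)` of the attaching circle). [folklore] -/
def tubeBasePt : ↥(handleTube 3 2) :=
  coreTubePt ⟨EuclideanSpace.single (0 : Fin 2) (1 : ℝ), by simp⟩

/-- **The swap as a partial diffeomorphism `T ⇀ D⁴ ∖ S`** with source `T` and target the belt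
tube (the shape consumed by `Manifold.IsSmoothEmbedding.comp_openPartialHomeomorph`). [folklore] -/
def swapPH : OpenPartialHomeomorph ↥(handleTube 3 2) ↥(beltPiece 3 2) :=
  haveI : Nonempty ↥(handleTube 3 2) := ⟨tubeBasePt⟩
  isOpenEmbedding_swapTube.toOpenPartialHomeomorph swapTube

/-- `swapPH` acts as `swapTube`. [folklore] -/
@[simp] theorem coe_swapPH : ⇑swapPH = swapTube := rfl

/-- The source of `swapPH` is all of `T`. [folklore] -/
theorem swapPH_source : swapPH.source = univ :=
  haveI : Nonempty ↥(handleTube 3 2) := ⟨tubeBasePt⟩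
  isOpenEmbedding_swapTube.toOpenPartialHomeomorph_source swapTube

/-- The target of `swapPH` is the belt tube. [folklore] -/
theorem swapPH_target : swapPH.target = range swapTube :=
  haveI : Nonempty ↥(handleTube 3 2) := ⟨tubeBasePt⟩
  isOpenEmbedding_swapTube.toOpenPartialHomeomorph_target swapTube

/-- `swapPH⁻¹ (σ y) = y`. [folklore] -/
@[simp] theorem swapPH_symm_swapTube (y : ↥(handleTube 3 2)) : swapPH.symm (swapTube y) = y :=
  swapPH.left_inv (by rw [swapPH_source]; exact mem_univ y)

/-- **The inverse of the swap is smooth on the belt tube** (near a point of the belt tube it is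
`σ⁻¹` restricted to the open `{x_μ ≠ 0}`, read through `ContMDiffAt.subtypeVal_comp_iff`).
[folklore] -/
theorem contMDiffOn_swapPH_symm : ContMDiffOn (𝓡∂ 4) (𝓡∂ 4) ∞ swapPH.symm swapPH.target := by
  classical
  rw [swapPH_target]
  rintro _ ⟨y, rfl⟩
  apply ContMDiffAt.contMDiffWithinAt
  -- a local smooth inverse: `σ⁻¹` after the retraction of `D⁴ ∖ S` onto `T^∨` (junk off `T^∨`)
  set π : ↥(beltPiece 3 2) → ↥muTube := fun b =>
    if hb : muSq 2 ((b : closedBall (0 : EuclideanSpace ℝ (Fin 4)) 1) : EuclideanSpace ℝ (Fin 4)) ≠ 0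
    then (⟨b.1, (mem_muTube (u := b.1)).2 hb⟩ : ↥muTube) else swapDiffeo y with hπ
  have hπ_of : ∀ {b : ↥(beltPiece 3 2)}
      (hb : muSq 2 ((b : closedBall (0 : EuclideanSpace ℝ (Fin 4)) 1) : EuclideanSpace ℝ (Fin 4)) ≠ 0),
      π b = ⟨b.1, (mem_muTube (u := b.1)).2 hb⟩ := fun hb => by
    simp only [hπ]
    exact dif_pos hb
  have hU : range swapTube ∈ 𝓝 (swapTube y) := isOpen_range_swapTube.mem_nhds (mem_range_self y)
  have hπs : ContMDiffAt (𝓡∂ 4) (𝓡∂ 4) ∞ π (swapTube y) := by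
    rw [← ContMDiffAt.subtypeVal_comp_iff]
    have hev : (Subtype.val ∘ π) =ᶠ[𝓝 (swapTube y)] Subtype.val := by
      filter_upwards [hU] with b hb
      rw [range_swapTube, mem_setOf_eq] at hb
      rw [comp_apply, hπ_of hb]
    exact contMDiff_subtype_val.contMDiffAt.congr_of_eventuallyEq hev
  have hg : ContMDiffAt (𝓡∂ 4) (𝓡∂ 4) ∞ (swapDiffeo.symm ∘ π) (swapTube y) :=
    swapDiffeo.symm.contMDiff.contMDiffAt.comp _ hπs
  refine hg.congr_of_eventuallyEq ?_
  filter_upwards [hU] with b hb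
  obtain ⟨y', rfl⟩ := hb
  rw [swapPH_symm_swapTube, comp_apply]
  rw [hπ_of (muSq_swapTube_ne_zero y')]
  exact (swapDiffeo.symm_apply_apply y').symm

/-! ### §3 The belt circle and the belt sphere in the model -/

/-- **The point `(0, 0, θ)` of the belt circle `{x_λ = 0, |x_μ| = 1} ⊂ ∂D⁴`** over `θ ∈ S¹`, as a
point of the handle `D⁴ ∖ S`: the swap of the attaching-circle point `coreTubePt θ = (θ, 0, 0)`.
[cite: Kosinski1993, VI §6] -/
def beltCirclePt (θ : sphere (0 : EuclideanSpace ℝ (Fin 2)) 1) : ↥(beltPiece 3 2) :=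
  swapTube (coreTubePt θ)

/-- Coordinates of the belt-circle point: `(0, 0, θ₀, θ₁)`. [folklore] -/
theorem coe_coe_beltCirclePt (θ : sphere (0 : EuclideanSpace ℝ (Fin 2)) 1) :
    (((beltCirclePt θ : ↥(beltPiece 3 2)) : closedBall (0 : EuclideanSpace ℝ (Fin 4)) 1) :
      EuclideanSpace ℝ (Fin 4)) =
      WithLp.toLp 2 ![0, 0, (θ : EuclideanSpace ℝ (Fin 2)) 0, (θ : EuclideanSpace ℝ (Fin 2)) 1] := by
  rw [beltCirclePt, coe_coe_swapTube, coe_coe_coreTubePt]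
  ext i
  fin_cases i <;> simp [corePt]

/-- `x_λ = 0` on the belt circle. [folklore] -/
theorem lamSq_beltCirclePt (θ : sphere (0 : EuclideanSpace ℝ (Fin 2)) 1) :
    lamSq 2 (((beltCirclePt θ : ↥(beltPiece 3 2)) : closedBall (0 : EuclideanSpace ℝ (Fin 4)) 1) :
      EuclideanSpace ℝ (Fin 4)) = 0 := by
  rw [beltCirclePt, lamSq_swapTube, coe_coe_coreTubePt, muSq_corePt]

/-- `|x_μ| = 1` on the belt circle. [folklore] -/
theorem muSq_beltCirclePt (θ : sphere (0 : EuclideanSpace ℝ (Fin 2)) 1) :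
    muSq 2 (((beltCirclePt θ : ↥(beltPiece 3 2)) : closedBall (0 : EuclideanSpace ℝ (Fin 4)) 1) :
      EuclideanSpace ℝ (Fin 4)) = 1 := by
  rw [beltCirclePt, coe_coe_swapTube, muSq_swapIso, coe_coe_coreTubePt, lamSq_corePt]

/-- The belt circle lies on `∂D⁴`. [folklore] -/
theorem norm_beltCirclePt (θ : sphere (0 : EuclideanSpace ℝ (Fin 2)) 1) :
    ‖(((beltCirclePt θ : ↥(beltPiece 3 2)) : closedBall (0 : EuclideanSpace ℝ (Fin 4)) 1) :
      EuclideanSpace ℝ (Fin 4))‖ = 1 := by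
  rw [beltCirclePt, coe_coe_swapTube, norm_swapIso, coe_coe_coreTubePt, norm_corePt]

/-- `beltCirclePt` is injective. [folklore] -/
theorem injective_beltCirclePt : Injective beltCirclePt :=
  injective_swapTube.comp injective_coreTubePt

/-- `beltCirclePt` is continuous. [folklore] -/
theorem continuous_beltCirclePt : Continuous beltCirclePt :=
  continuous_swapTube.comp continuous_coreTubePt

/-- On the closed ball, `|x_μ|² = 1` forces `x_λ = 0` (and `‖x‖ = 1`). [folklore] -/
theorem lamSq_eq_zero_of_muSq_eq_one {u : EuclideanSpace ℝ (Fin 4)} (hu : ‖u‖ ≤ 1)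
    (h : muSq 2 u = 1) : lamSq 2 u = 0 ∧ ‖u‖ = 1 := by
  have hs := lamSq_add_muSq 2 u
  have h1 : ‖u‖ ^ 2 ≤ 1 := by nlinarith [norm_nonneg u]
  have hl := lamSq_nonneg 2 u
  have hl0 : lamSq 2 u = 0 := by linarith
  refine ⟨hl0, ?_⟩
  have : ‖u‖ ^ 2 = 1 := by linarith
  nlinarith [norm_nonneg u]

/-- **Every point of the belt sphere `{|x_μ| = 1} ⊂ D⁴ ∖ S` is `beltCirclePt θ`** (`θ = x_μ`).
[folklore] -/
theorem exists_beltCirclePt_eq {b : ↥(beltPiece 3 2)}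
    (hb : muSq 2 ((b : closedBall (0 : EuclideanSpace ℝ (Fin 4)) 1) : EuclideanSpace ℝ (Fin 4)) = 1) :
    ∃ θ, beltCirclePt θ = b := by
  have hb0 : muSq 2 ((b : closedBall (0 : EuclideanSpace ℝ (Fin 4)) 1) : EuclideanSpace ℝ (Fin 4)) ≠ 0 := by
    rw [hb]; exact one_ne_zero
  obtain ⟨y, rfl⟩ : b ∈ range swapTube := by rw [range_swapTube]; exact hb0
  have hy : ((y : closedBall (0 : EuclideanSpace ℝ (Fin 4)) 1)) ∈ attachingSphereSet 3 2 := by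
    rw [mem_attachingSphereSet, ← muSq_swapIso, ← coe_coe_swapTube]; exact hb
  obtain ⟨θ, rfl⟩ := exists_coreTubePt_eq hy
  exact ⟨θ, rfl⟩

/-! ### §4 Registered helper -/

/-- `swapTube` is a smooth embedding (the identity embedding precomposed with the partial
diffeomorphism `swapPH`). [folklore] -/
theorem isSmoothEmbedding_swapTube : Manifold.IsSmoothEmbedding (𝓡∂ 4) (𝓡∂ 4) ∞ swapTube :=
  (Manifold.IsSmoothEmbedding.id (I := 𝓡∂ 4) (M := ↥(beltPiece 3 2)) (n := ∞)).comp_openPartialHomeomorph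
    swapPH swapPH_source (contMDiff_swapTube.contMDiffOn.congr fun _ _ => rfl) contMDiffOn_swapPH_symm

/-- **Registered helper `helper_dualAttachingMap_swapTube` (sub-goal T3a-1a of NF6
`stub_steinRealisation`, wave 1, lead c5): Kosinski's tube `T = {x_λ ≠ 0}` is carried by the block
swap `σ (x₀, x₁, x₂, x₃) = (x₂, x₃, x₀, x₁)` smoothly and openly onto the belt tube `{x_μ ≠ 0}` of the
handle `D⁴ ∖ S`** — the symmetry of the model handle under which the attaching sphere becomes the
belt sphere (Milnor's dual handle). [cite: MilnorHCobordism1965, §3] -/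
theorem helper_dualAttachingMap_swapTube :
    ∃ s : ↥(Literature.Topology.FourManifolds.handleTube 3 2) →
        ↥(Literature.Topology.FourManifolds.beltPiece 3 2),
      Manifold.IsSmoothEmbedding (𝓡∂ 4) (𝓡∂ 4) ∞ s ∧ IsOpen (Set.range s) ∧
      (∀ y : ↥(Literature.Topology.FourManifolds.handleTube 3 2),
        ((s y : Metric.closedBall (0 : EuclideanSpace ℝ (Fin 4)) 1) : EuclideanSpace ℝ (Fin 4)) =
          WithLp.toLp 2
            ![((y : Metric.closedBall (0 : EuclideanSpace ℝ (Fin 4)) 1) : EuclideanSpace ℝ (Fin 4)) 2,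
              ((y : Metric.closedBall (0 : EuclideanSpace ℝ (Fin 4)) 1) : EuclideanSpace ℝ (Fin 4)) 3,
              ((y : Metric.closedBall (0 : EuclideanSpace ℝ (Fin 4)) 1) : EuclideanSpace ℝ (Fin 4)) 0,
              ((y : Metric.closedBall (0 : EuclideanSpace ℝ (Fin 4)) 1) : EuclideanSpace ℝ (Fin 4)) 1]) ∧
      Set.range s = {b : ↥(Literature.Topology.FourManifolds.beltPiece 3 2) |
        Literature.Topology.FourManifolds.muSq 2
          ((b : Metric.closedBall (0 : EuclideanSpace ℝ (Fin 4)) 1) : EuclideanSpace ℝ (Fin 4)) ≠ 0} := by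
  refine ⟨swapTube, isSmoothEmbedding_swapTube, isOpen_range_swapTube, fun y => ?_, range_swapTube⟩
  rw [coe_coe_swapTube]
  ext j
  fin_cases j <;> simp

end Summit.SmoothPoincare4.SmoothPoincare4.Theorems.AcyclicBisectionExists.ModpBraidOrbits

end
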